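import Literature.NumberTheory.GaloisRepresentations.ContinuousCorestrictionComp
import HarnessLib

/-!
# A vanishing test for corestricted classes: `cor_{N→U}[φ] = 0` with `φ` valued in a `U`-anisotropic,
# `N`-fixed kernel forces the norm cocycle `Σ_{x ∈ U/N} s(x)·φ(s(x)⁻¹ n s(x))` to vanish IDENTICALLY on `N`

For `N ⊴ G` open and of finite index in `U ≥ N`, a topological representation `X` of `G`, an additive
`U`-equivariant `g : X → X`, and a continuous 1-cocycle `φ` of `N` with values in `ker g`:
if `(im g)^U = 0` (no non-zero `U`-invariant in the image of `g`) and `N` acts trivially on `ker g`, then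
`cor_{N→U}[φ] = 0` in `H¹(U, X)` implies `Σ_{x ∈ U/N} s(x)·φ(s(x)⁻¹ n s(x)) = 0` for EVERY `n ∈ N` — an identity of
cocycles, not merely of classes (`sum_conj_apply_eq_zero_of_coresLe_eq_zero`).  Proof: the transfer cocycle
`cor_s φ` is a coboundary `u ↦ u v − v` (`oneCocycleClass_eq_zero_iff`); it is `ker g`-valued, so `g v` is
`U`-invariant, hence `0`; so `v ∈ ker g` is `N`-fixed and `cor_s φ` vanishes on `N`, where it equals the norm sum
(normal case of the double-coset formula, as in `ContinuousCorestrictionResNormal.lean`).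

This is the mechanism «`(B/A)^U = 0 ⇒ H¹(U, A) → H¹(U, B)` injective» for `A = ker g ≤ B = X` read through `g`
(`B/A ≅ im g`), in the cocycle form consumed by Kummer-theoretic non-vanishing tests (the class-level restriction
to `N` would lose the line of coboundaries `n ↦ n w − w`, `w ∉ A`).  No new objects, no named facts.

References: J. Neukirch, A. Schmidt, K. Wingberg, *Cohomology of Number Fields*, 2nd ed. (2008), I §5 (1.5.6)–(1.5.7),
I §6 (1.6.6) [NeukirchSchmidtWingberg2008]; J.-P. Serre, *Local Fields* (1979), VII §5–§6 [SerreLocalFields1979];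
*Galois Cohomology* (1997), I §2.2–§2.4 [SerreGaloisCohomology1997].
-/

noncomputable section

open CategoryTheory

universe u v

namespace Literature.NumberTheory.GaloisRepresentations

open Literature.NumberTheory.EllipticCurves (schreierElt schreierElt_mem schreierElt_coe
  rep_mul_schreierElt schreierElt_mul rep_inv_mul_rep_mem subgroupInclusion
  subgroupInclusion_apply_coe subgroupConj subgroupConj_apply_coe)

variable {R : Type u} [Ring R] [TopologicalSpace R]
variable {G : Type v} [Group G] [TopologicalSpace G] [IsTopologicalGroup G]
variable (X : TopRep.{v} R G) {N U : Subgroup G}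

omit [TopologicalSpace G] [IsTopologicalGroup G] in
/-- For `N` normal, elements of `N` act trivially on `U/N`. [cite: NeukirchSchmidtWingberg2008, I §5 (1.5.7)] -/
private theorem smul_quotient_eq_self_of_mem [N.Normal] {n : U} (hn : (n : G) ∈ N)
    (x : U ⧸ N.subgroupOf U) : n • x = x := by
  induction x using QuotientGroup.induction_on with
  | H u =>
    rw [MulAction.Quotient.smul_mk, QuotientGroup.eq, Subgroup.mem_subgroupOf, smul_eq_mul]
    have : (((n * u)⁻¹ * u : U) : G) = (u : G)⁻¹ * (n : G)⁻¹ * ((u : G)⁻¹)⁻¹ := by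
      push_cast; group
    rw [this]
    exact Subgroup.Normal.conj_mem inferInstance _ (N.inv_mem hn) _

/-- **The transfer cocycle on `N` is the norm sum** (normal case): for `n ∈ N`,
`(cor_s φ)(n) = Σ_{x ∈ U/N} s(x)·φ(s(x)⁻¹ n s(x))`. [cite: NeukirchSchmidtWingberg2008, I §5 (1.5.6)–(1.5.7)] -/
theorem transferCocycle_pullback_apply_of_mem [N.Normal] (h : N ≤ U) (hN : IsOpen (N : Set G))
    [Fintype (U ⧸ N.subgroupOf U)] {s : U ⧸ N.subgroupOf U → U}
    (hs : ∀ x, (s x : U ⧸ N.subgroupOf U) = x) (φ : contOneCocycles (subgroupRep X N)) (n : N) :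
    (transferCocycle (subgroupRep X U) (N.subgroupOf U) (isOpen_subgroupOf U hN) hs
        (contOneCocycles.pullback (subgroupOfHom h)
          (Y := subgroupRep (subgroupRep X U) (N.subgroupOf U))
          (TopRep.ofHom ⟨ContinuousLinearMap.id R X, fun _ => rfl⟩) φ)).1 (subgroupInclusion h n) =
      ∑ x, X.ρ ((s x : U) : G) (φ.1 (subgroupConj N ((s x : U) : G) n)) := by
  rw [transferCocycle_pullback_apply X h hN hs]
  refine Finset.sum_congr rfl fun x _ ↦ ?_
  have hnx : subgroupInclusion h n • x = x := smul_quotient_eq_self_of_mem (by simp [n.2]) x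
  rw [hnx]
  congr 2
  apply Subtype.ext
  rw [subgroupOfHom_apply_coe, schreierElt_coe, subgroupConj_apply_coe, hnx]
  simp [subgroupInclusion_apply_coe]

/-- ★ **Vanishing test for a corestricted class.**  Let `N ⊴ G` be open of finite index in `U ≥ N`, `g : X → X` additive
and `U`-equivariant with `(im g)^U = 0`, `N` acting trivially on `ker g`, and `φ ∈ Z¹(N, X)` valued in `ker g`.  If
`cor_{N→U}[φ] = 0` in `H¹(U, X)`, then the norm cocycle vanishes identically on `N`:
`Σ_{x ∈ U/N} s(x)·φ(s(x)⁻¹ n s(x)) = 0` for every `n ∈ N`.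
[cite: NeukirchSchmidtWingberg2008, I §5 (1.5.6)–(1.5.7) and I §6 (1.6.6)] [cite: SerreLocalFields1979, VII §5–§6] -/
theorem sum_conj_apply_eq_zero_of_coresLe_eq_zero [N.Normal] (h : N ≤ U) (hN : IsOpen (N : Set G))
    [Fintype (U ⧸ N.subgroupOf U)] {s : U ⧸ N.subgroupOf U → U}
    (hs : ∀ x, (s x : U ⧸ N.subgroupOf U) = x) (g : X →+ X)
    (hg : ∀ (u : U) (x : X), g (X.ρ (u : G) x) = X.ρ (u : G) (g x))
    (hinv : ∀ x : X, (∀ u : U, X.ρ (u : G) (g x) = g x) → g x = 0)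
    (hfix : ∀ x : X, g x = 0 → ∀ n : N, X.ρ (n : G) x = x)
    (φ : contOneCocycles (subgroupRep X N)) (hφ : ∀ n, g (φ.1 n) = 0)
    (h0 : coresLe X h hN (oneCocycleClass _ φ) = 0) (n : N) :
    ∑ x, X.ρ ((s x : U) : G) (φ.1 (subgroupConj N ((s x : U) : G) n)) = 0 := by
  rw [coresLe_oneCocycleClass X h hN hs φ, oneCocycleClass_eq_zero_iff] at h0
  obtain ⟨v, hv⟩ := h0
  -- the transfer cocycle is `ker g`-valued, so `g v` is `U`-invariant, hence zero
  have hgv : g v = 0 := by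
    refine hinv v fun u ↦ ?_
    have hu := congrArg g (hv u)
    rw [transferCocycle_pullback_apply X h hN hs, map_sum, Finset.sum_eq_zero (fun x _ ↦ by rw [hg, hφ, map_zero]),
      eq_comm, map_sub, sub_eq_zero] at hu
    change g (X.ρ (u : G) v) = g v at hu
    rwa [hg] at hu
  -- hence `v ∈ ker g` is fixed by `N`, and the transfer cocycle vanishes on `N`, where it is the norm sum
  rw [← transferCocycle_pullback_apply_of_mem X h hN hs φ n, hv, sub_eq_zero]
  change X.ρ ((subgroupInclusion h n : U) : G) v = v
  rw [subgroupInclusion_apply_coe]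
  exact hfix v hgv n

end Literature.NumberTheory.GaloisRepresentations

end
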